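import Summits.AtomisticToContinuum.BoseEinsteinCondensation.Theses.BECThomsonPrinciple
import Literature.MathematicalPhysics.QuantumManyBody.SquareWellScatteringLength
import Literature.MathematicalPhysics.QuantumManyBody.PeriodicBoseGasThm31
import Literature.MathematicalPhysics.QuantumManyBody.BoseGasThermodynamicLimitRuelle
import Literature.MathematicalPhysics.QuantumManyBody.TorusFockSectorDictionary
import Literature.Probability.Distributions.GaussianPiDensity

/-!
# Negative lemmas for crux `DensityResponse` (stmt-AtomisticToContinuum-9481), II: the modulated
# orbital `φ_L = c(1 + ½cos(2πx₀/L))`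

Supports (does not close) stmt-AtomisticToContinuum-9481 (crux `DensityResponse`, route
`BECThomsonPrinciple`, rank 4).  Importable landed copy of the cdisprove seat's standing file
`Cruxes/DensityResponse/Disproof.lean` (generation 2), split by topic; `sorry`-free, standard axioms.
Nothing here asserts a `Theses` decl positively.

* §4 the one-body orbital of the witness: smooth, `L`-periodic, `|∂_w φ_L| ≤ (2π/L)|w||φ_L|`
  (`norm_fderiv_orb_le` — the profile never drops below half its mean), and its cell integrals
  `∫|φ_L|² = 1`, `∫ 2cos θ |φ_L|² = 8/9` (`integral_cell_norm_orb_sq`,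
  `integral_cell_two_cos_norm_orb_sq`; plane-wave orthogonality `integral_cell_cos` from the tree's
  `integral_cell_cellWave`).
-/

noncomputable section

open MeasureTheory Set Filter Metric
open scoped ENNReal NNReal BigOperators Classical

namespace Summit.AtomisticToContinuum.BoseEinsteinCondensation.Theorems.DensityResponse.Negative

open Literature.MathematicalPhysics.QuantumManyBody.BoseGas

/-! ## §4 The modulated orbital `φ_L(x) = c (1 + ½ cos(2πx₀/L))` -/

/-- The phase `θ(x) = 2πx₀/L`. [folklore] -/
def θL (L : ℝ) (x : Space) : ℝ := 2 * Real.pi / L * x 0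

/-- The real profile `1 + ½ cos θ` (modulation `η = 1/4` of the constant state). [folklore] -/
def prof (L : ℝ) (x : Space) : ℝ := 1 + 1 / 2 * Real.cos (θL L x)

/-- The normalisation `c = (9L³/8)^{-1/2}`. [folklore] -/
def cL (L : ℝ) : ℝ := (Real.sqrt (9 / 8 * L ^ 3))⁻¹

/-- The orbital `φ_L = c (1 + ½ cos θ)`, as a complex-valued function. [folklore] -/
def orb (L : ℝ) (x : Space) : ℂ := ((cL L * prof L x : ℝ) : ℂ)

/-- `½ ≤ 1 + ½cos θ ≤ 3/2`. [folklore] -/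
theorem prof_bounds (L : ℝ) (x : Space) : 1 / 2 ≤ prof L x ∧ prof L x ≤ 3 / 2 := by
  unfold prof
  constructor <;> nlinarith [Real.neg_one_le_cos (θL L x), Real.cos_le_one (θL L x)]

/-- `c > 0`. [folklore] -/
theorem cL_pos {L : ℝ} (hL : 0 < L) : 0 < cL L := by
  unfold cL; positivity

/-- `c² = 8/(9L³)`. [folklore] -/
theorem cL_sq {L : ℝ} (hL : 0 < L) : cL L ^ 2 = 8 / (9 * L ^ 3) := by
  unfold cL
  rw [inv_pow, Real.sq_sqrt (by positivity)]
  field_simp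

/-- `|φ_L| = c (1 + ½cos θ)`. [folklore] -/
theorem norm_orb {L : ℝ} (hL : 0 < L) (x : Space) : ‖orb L x‖ = cL L * prof L x := by
  unfold orb
  rw [Complex.norm_real, Real.norm_of_nonneg]
  exact mul_nonneg (cL_pos hL).le (by linarith [(prof_bounds L x).1])

/-- `|φ_L| > 0`. [folklore] -/
theorem norm_orb_pos {L : ℝ} (hL : 0 < L) (x : Space) : 0 < ‖orb L x‖ := by
  rw [norm_orb hL]
  exact mul_pos (cL_pos hL) (by linarith [(prof_bounds L x).1])

/-- `c/2 ≤ |φ_L|`. [folklore] -/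
theorem half_cL_le_norm_orb {L : ℝ} (hL : 0 < L) (x : Space) : cL L * (1 / 2) ≤ ‖orb L x‖ := by
  rw [norm_orb hL]
  exact mul_le_mul_of_nonneg_left (prof_bounds L x).1 (cL_pos hL).le

/-- The profile is smooth. [folklore] -/
theorem contDiff_prof (L : ℝ) : ContDiff ℝ ⊤ (prof L) := by
  unfold prof θL; fun_prop

/-- The orbital is smooth. [folklore] -/
theorem contDiff_orb (L : ℝ) : ContDiff ℝ ⊤ (orb L) := by
  have : orb L = fun x => Complex.ofRealCLM (cL L * prof L x) := by
    funext x; rw [Complex.ofRealCLM_apply]; rfl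
  rw [this]
  exact Complex.ofRealCLM.contDiff.comp (contDiff_const.mul (contDiff_prof L))

/-- The orbital is continuous. [folklore] -/
theorem continuous_orb (L : ℝ) : Continuous (orb L) := (contDiff_orb L).continuous

/-- `φ_L` is `L`-periodic along every axis. [folklore] -/
theorem orb_periodic {L : ℝ} (hL : L ≠ 0) (x : Space) (k : Fin 3) :
    orb L (x + EuclideanSpace.single k L) = orb L x := by
  have hθ : Real.cos (θL L (x + EuclideanSpace.single k L)) = Real.cos (θL L x) := by
    unfold θL
    simp only [PiLp.add_apply, PiLp.single_apply]
    split_ifs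
    · rw [mul_add, div_mul_cancel₀ _ hL, Real.cos_add_two_pi]
    · rw [add_zero]
  unfold orb prof
  rw [hθ]

/-- The derivative of the profile. [folklore] -/
theorem hasFDerivAt_prof (L : ℝ) (x : Space) :
    HasFDerivAt (prof L)
      ((1 / 2 : ℝ) • (-Real.sin (θL L x) •
        ((2 * Real.pi / L) • EuclideanSpace.proj (𝕜 := ℝ) (0 : Fin 3)))) x := by
  have h0 : HasFDerivAt (fun y : Space => θL L y)
      ((2 * Real.pi / L) • EuclideanSpace.proj (𝕜 := ℝ) (0 : Fin 3)) x :=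
    ((EuclideanSpace.proj (𝕜 := ℝ) (0 : Fin 3)).hasFDerivAt).const_mul (2 * Real.pi / L)
  exact ((h0.cos).const_mul (1 / 2)).const_add 1

/-- `|∂_w prof| ≤ (π/L) |w|`. [folklore] -/
theorem norm_fderiv_prof_le {L : ℝ} (hL : 0 < L) (x w : Space) :
    ‖fderiv ℝ (prof L) x w‖ ≤ Real.pi / L * ‖w‖ := by
  rw [(hasFDerivAt_prof L x).fderiv]
  simp only [smul_apply, smul_eq_mul]
  have hproj : ‖(EuclideanSpace.proj (𝕜 := ℝ) (0 : Fin 3)) w‖ ≤ ‖w‖ := PiLp.norm_apply_le w 0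
  have hsin : |Real.sin (θL L x)| ≤ 1 := Real.abs_sin_le_one _
  rw [Real.norm_eq_abs, abs_mul, abs_mul, abs_mul, abs_neg,
    abs_of_pos (show (0 : ℝ) < 1 / 2 by norm_num), abs_of_pos (by positivity : (0 : ℝ) < 2 * Real.pi / L)]
  rw [Real.norm_eq_abs] at hproj
  calc 1 / 2 * (|Real.sin (θL L x)| * (2 * Real.pi / L * |(EuclideanSpace.proj (𝕜 := ℝ) (0 : Fin 3)) w|))
      ≤ 1 / 2 * (1 * (2 * Real.pi / L * ‖w‖)) := by gcongr
    _ = Real.pi / L * ‖w‖ := by ring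

/-- The derivative of the orbital. [folklore] -/
theorem hasFDerivAt_orb (L : ℝ) (x : Space) :
    HasFDerivAt (orb L) (Complex.ofRealCLM.comp (cL L • fderiv ℝ (prof L) x)) x := by
  have h1 : HasFDerivAt (fun y => cL L * prof L y) (cL L • fderiv ℝ (prof L) x) x :=
    ((hasFDerivAt_prof L x).differentiableAt.hasFDerivAt).const_mul (cL L)
  have h2 := Complex.ofRealCLM.hasFDerivAt.comp x h1
  have : orb L = fun y => Complex.ofRealCLM (cL L * prof L y) := by
    funext y; rw [Complex.ofRealCLM_apply]; rfl
  rw [this]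
  exact h2

/-- **`|∂_w φ_L| ≤ (2π/L) |w| |φ_L|`** (the profile never drops below half its mean). [folklore] -/
theorem norm_fderiv_orb_le {L : ℝ} (hL : 0 < L) (x w : Space) :
    ‖fderiv ℝ (orb L) x w‖ ≤ 2 * Real.pi / L * ‖w‖ * ‖orb L x‖ := by
  rw [(hasFDerivAt_orb L x).fderiv, ContinuousLinearMap.comp_apply, smul_apply,
    Complex.ofRealCLM_apply, Complex.norm_real, norm_smul, Real.norm_of_nonneg (cL_pos hL).le]
  have h := norm_fderiv_prof_le hL x w
  calc cL L * ‖fderiv ℝ (prof L) x w‖ ≤ cL L * (Real.pi / L * ‖w‖) :=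
        mul_le_mul_of_nonneg_left h (cL_pos hL).le
    _ = 2 * Real.pi / L * ‖w‖ * (cL L * (1 / 2)) := by ring
    _ ≤ 2 * Real.pi / L * ‖w‖ * ‖orb L x‖ :=
        mul_le_mul_of_nonneg_left (half_cL_le_norm_orb hL x) (by positivity)

/-! ### Cell integrals of the orbital -/

/-- Bounded continuous functions are integrable on the cell. [folklore] -/
theorem integrableOn_cell_of_bound {E : Type*} [NormedAddCommGroup E] {g : Space → E}
    (hg : Continuous g) {M : ℝ} (hM : ∀ x, ‖g x‖ ≤ M) (L : ℝ) : IntegrableOn g (cell L) :=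
  Measure.integrableOn_of_bounded (by rw [volume_cell]; exact ENNReal.pow_ne_top ENNReal.ofReal_ne_top)
    hg.aestronglyMeasurable (ae_of_all _ hM)

/-- The cell has finite volume. [folklore] -/
theorem volume_cell_ne_top (L : ℝ) : volume (cell L) ≠ ⊤ := by
  rw [volume_cell]; exact ENNReal.pow_ne_top ENNReal.ofReal_ne_top

/-- `|cell| = L³` as a real number. [folklore] -/
theorem volume_real_cell {L : ℝ} (hL : 0 ≤ L) : volume.real (cell L) = L ^ 3 := by
  rw [measureReal_def, volume_cell, ENNReal.toReal_pow, ENNReal.toReal_ofReal hL]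

/-- The phase is continuous. [folklore] -/
theorem continuous_θL (L : ℝ) : Continuous (θL L) := by unfold θL; fun_prop

/-- **`∫_cell cos(jθ) = 0`** for `j ≠ 0` (plane-wave orthogonality on the torus). [folklore] -/
theorem integral_cell_cos {L : ℝ} (hL : 0 < L) {j : ℤ} (hj : j ≠ 0) :
    ∫ x in cell L, Real.cos (j * θL L x) = 0 := by
  have hw : ∀ x, Real.cos (j * θL L x) = RCLike.re (cellWave L (Pi.single 0 j) x) := by
    intro x
    rw [cellWave_apply, RCLike.re_to_complex]
    have : (2 * ↑Real.pi * Complex.I * ↑(∑ k, ((Pi.single 0 j : Fin 3 → ℤ) k : ℝ) * x k) / ↑L : ℂ) =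
        ((j * θL L x : ℝ) : ℂ) * Complex.I := by
      simp only [Pi.single_apply, Int.cast_ite, Int.cast_zero, ite_mul, zero_mul,
        Finset.sum_ite_eq', Finset.mem_univ, if_true, θL]
      push_cast
      field_simp
    rw [this, Complex.exp_ofReal_mul_I_re]
  simp_rw [hw]
  rw [integral_re ((integrableOn_cell_of_bound (continuous_cellWave L _)
    (fun x => (norm_cellWave L _ x).le) L)), integral_cell_cellWave hL, if_neg, map_zero]
  intro h
  exact hj (by simpa using congr_fun h 0)

/-- `(1 + ½cos θ)² = 9/8 + cos θ + cos(2θ)/8`. [folklore] -/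
theorem prof_sq_eq (L : ℝ) (x : Space) :
    prof L x ^ 2 = 9 / 8 + Real.cos ((1 : ℤ) * θL L x) + 1 / 8 * Real.cos ((2 : ℤ) * θL L x) := by
  unfold prof
  push_cast
  rw [one_mul, Real.cos_two_mul]
  ring

/-- `2cos θ (1 + ½cos θ)² = 1 + (19/8)cos θ + cos 2θ + cos(3θ)/8`. [folklore] -/
theorem two_cos_mul_prof_sq_eq (L : ℝ) (x : Space) :
    2 * Real.cos (θL L x) * prof L x ^ 2 = 1 + 19 / 8 * Real.cos ((1 : ℤ) * θL L x) +
      Real.cos ((2 : ℤ) * θL L x) + 1 / 8 * Real.cos ((3 : ℤ) * θL L x) := by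
  unfold prof
  push_cast
  rw [one_mul, Real.cos_two_mul, Real.cos_three_mul]
  ring

/-- `cos(jθ)` is integrable on the cell. [folklore] -/
theorem integrableOn_cell_cos (L : ℝ) (j : ℤ) : IntegrableOn (fun x => Real.cos (j * θL L x)) (cell L) :=
  integrableOn_cell_of_bound (Real.continuous_cos.comp (continuous_const.mul (continuous_θL L)))
    (fun x => by rw [Real.norm_eq_abs]; exact Real.abs_cos_le_one _) L

/-- `∫_cell (1 + ½cos θ)² = 9L³/8`. [folklore] -/
theorem integral_cell_prof_sq {L : ℝ} (hL : 0 < L) : ∫ x in cell L, prof L x ^ 2 = 9 / 8 * L ^ 3 := by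
  simp_rw [prof_sq_eq]
  have hc : IntegrableOn (fun _ : Space => (9 / 8 : ℝ)) (cell L) := integrableOn_const (volume_cell_ne_top L)
  have h1 := integrableOn_cell_cos L 1
  have h2 := (integrableOn_cell_cos L 2).const_mul (1 / 8)
  rw [integral_add (hc.fun_add h1) h2, integral_add hc h1, integral_const_mul,
    integral_cell_cos hL one_ne_zero, integral_cell_cos hL two_ne_zero,
    setIntegral_const, volume_real_cell hL.le, smul_eq_mul]
  ring

/-- `∫_cell 2cos θ (1 + ½cos θ)² = L³`. [folklore] -/
theorem integral_cell_two_cos_prof_sq {L : ℝ} (hL : 0 < L) :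
    ∫ x in cell L, 2 * Real.cos (θL L x) * prof L x ^ 2 = L ^ 3 := by
  simp_rw [two_cos_mul_prof_sq_eq]
  have hc : IntegrableOn (fun _ : Space => (1 : ℝ)) (cell L) := integrableOn_const (volume_cell_ne_top L)
  have h1 := (integrableOn_cell_cos L 1).const_mul (19 / 8)
  have h2 := integrableOn_cell_cos L 2
  have h3 := (integrableOn_cell_cos L 3).const_mul (1 / 8)
  rw [integral_add ((hc.fun_add h1).fun_add h2) h3, integral_add (hc.fun_add h1) h2, integral_add hc h1,
    integral_const_mul, integral_const_mul, integral_cell_cos hL one_ne_zero,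
    integral_cell_cos hL two_ne_zero, integral_cell_cos hL (by norm_num), setIntegral_const,
    volume_real_cell hL.le, smul_eq_mul]
  ring

/-- `|φ_L|² = c²(1 + ½cos θ)²`. [folklore] -/
theorem norm_orb_sq {L : ℝ} (hL : 0 < L) (x : Space) : ‖orb L x‖ ^ 2 = cL L ^ 2 * prof L x ^ 2 := by
  rw [norm_orb hL, mul_pow]

/-- **Normalisation**: `∫_cell |φ_L|² = 1`. [folklore] -/
theorem integral_cell_norm_orb_sq {L : ℝ} (hL : 0 < L) : ∫ x in cell L, ‖orb L x‖ ^ 2 = 1 := by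
  simp_rw [norm_orb_sq hL]
  rw [integral_const_mul, integral_cell_prof_sq hL, cL_sq hL]
  field_simp

/-- **Source**: `∫_cell 2cos θ |φ_L|² = 8/9`. [folklore] -/
theorem integral_cell_two_cos_norm_orb_sq {L : ℝ} (hL : 0 < L) :
    ∫ x in cell L, 2 * Real.cos (θL L x) * ‖orb L x‖ ^ 2 = 8 / 9 := by
  simp_rw [norm_orb_sq hL]
  have : ∀ x, 2 * Real.cos (θL L x) * (cL L ^ 2 * prof L x ^ 2) =
      cL L ^ 2 * (2 * Real.cos (θL L x) * prof L x ^ 2) := fun x => by ring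
  simp_rw [this]
  rw [integral_const_mul, integral_cell_two_cos_prof_sq hL, cL_sq hL]
  field_simp

/-- `|φ_L| ≤ 3c/2`. [folklore] -/
theorem norm_orb_le {L : ℝ} (hL : 0 < L) (x : Space) : ‖orb L x‖ ≤ cL L * (3 / 2) := by
  rw [norm_orb hL]
  exact mul_le_mul_of_nonneg_left (prof_bounds L x).2 (cL_pos hL).le

/-- `|φ_L|²` is integrable on the cell. [folklore] -/
theorem integrableOn_cell_norm_orb_sq {L : ℝ} (hL : 0 < L) :
    IntegrableOn (fun x => ‖orb L x‖ ^ 2) (cell L) := by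
  refine integrableOn_cell_of_bound (g := fun x => ‖orb L x‖ ^ 2) ((continuous_orb L).norm.pow 2)
    (M := (cL L * (3 / 2)) ^ 2) (fun x => ?_) L
  rw [Real.norm_eq_abs, abs_of_nonneg (sq_nonneg _)]
  exact pow_le_pow_left₀ (norm_nonneg _) (norm_orb_le hL x) 2

/-- **Normalisation in `ℝ≥0∞`**: `∫⁻_cell |φ_L|² = 1`. [folklore] -/
theorem lintegral_cell_orb_sq {L : ℝ} (hL : 0 < L) :
    ∫⁻ x in cell L, (‖orb L x‖₊ : ℝ≥0∞) ^ 2 = 1 := by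
  have h : ∀ x, (‖orb L x‖₊ : ℝ≥0∞) ^ 2 = ENNReal.ofReal (‖orb L x‖ ^ 2) := by
    intro x
    rw [ENNReal.ofReal_pow (norm_nonneg _), ofReal_norm]
    rfl
  simp_rw [h]
  rw [← ofReal_integral_eq_lintegral_ofReal (integrableOn_cell_norm_orb_sq hL)
    (ae_of_all _ fun x => by positivity), integral_cell_norm_orb_sq hL, ENNReal.ofReal_one]

/-- `|φ_L|²` is measurable. [folklore] -/
theorem measurable_orb_sq (L : ℝ) : Measurable fun x => (‖orb L x‖₊ : ℝ≥0∞) ^ 2 :=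
  ((continuous_orb L).measurable.nnnorm.coe_nnreal_ennreal).pow_const 2


end Summit.AtomisticToContinuum.BoseEinsteinCondensation.Theorems.DensityResponse.Negative

end
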